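import Summits.MatrixMultiplication.OmegaCensus.StrongUSPHallCert

/-!
# ω-census, family (b1-S): bitmask-table closed-set certificates for strong USPs (v3 checker)

HONEST FRAMING (pub-omega census; verbatim): lottery ticket; floor = certified bounds/negative ranges.
Census bookkeeping, not progress on `ω` (tree: `ω < 2.373`; every strong-USP row is `≥ 2.65`).
Same mathematics as `StrongUSPHallCert.lean` with CLOSED-SET blocks (a set `S` closed in a projection of the allowed
triples admits no silent perfect matching edge from outside `S` into `S`, because a permutation mapping the finite `S` into
itself maps it onto itself) and a kernel-friendly layout: silence by BITMASKS (`colMask`, `pairMask`: `k` `Nat.land` per row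
pair), the allowed set as rows `(a, [(b, mask of c)])` with zero masks dropped, blocks `(p, S-bitmask)`.  Reach at DEFAULT
limits (farm): Anderson–Le (23,7) ≈ 5 s, (35,8) ≈ 20 s, (52,9) ≈ 15 s, (78,10) ≈ 30 s (instances in `StrongUSPMaskCertAL.lean`;
(23,7)/(35,8) are certified by the stpp-1 seat's files — one kernel instance per object).  Soundness:
`isStrongUSP_of_suspMaskCheck`.  Certificates: the seat's `code/susp_cert2.py` (reach-sets of the projection digraphs).
References: Cohn–Kleinberg–Szegedy–Umans 2005 §3; Anderson–Ji–Xu arXiv:2301.00074 §3.1; Anderson–Le arXiv:2307.06463 App. A.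
-/

namespace Summit.MatrixMultiplication.OmegaCensus

open Literature.Computability.AlgebraicComplexity Equiv

variable {s k : ℕ}

/-! ## The checker -/

/-- Boolean "exactly two of `a = 1, b = 2, c = 3`" on symbol codes `0,1,2`. [cite: CohnKleinbergSzegedyUmans2005, §3 (p. 5)] -/
def exactlyTwoB (a b c : Fin 3) : Bool :=
  ((if a = 0 then 1 else 0) + (if b = 1 then 1 else 0) + (if c = 2 then 1 else 0) : ℕ) == 2
/-- Column mask: bit `c` set iff the symbol triple `(x, y, row c i)` is NOT "exactly two" at coordinate `i`. [folklore] -/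
def colMask (row : Fin s → Fin k → Fin 3) (i : Fin k) (x y : Fin 3) : ℕ :=
  (List.finRange s).foldl (fun m c => if exactlyTwoB x y (row c i) then m else m ||| 2 ^ c.val) 0
/-- The nine column masks of coordinate `i`, in the order `(x,y) = (0,0),(0,1),…,(2,2)`. [folklore] -/
def colRow (row : Fin s → Fin k → Fin 3) (i : Fin k) : List ℕ :=
  [colMask row i 0 0, colMask row i 0 1, colMask row i 0 2, colMask row i 1 0, colMask row i 1 1, colMask row i 1 2,
   colMask row i 2 0, colMask row i 2 1, colMask row i 2 2]
/-- Lookup in a nine-entry list by a symbol pair. [folklore] -/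
def look9 (L : List ℕ) (x y : Fin 3) : ℕ :=
  L.getD (3 * x.val + y.val) 0
/-- The table of column masks, indexed by coordinate. [folklore] -/
def colTab (row : Fin s → Fin k → Fin 3) : List (List ℕ) :=
  (List.finRange k).map fun i => colRow row i
/-- Pair mask: bit `c` (`c < s`) set iff the row triple `(a, b, c)` is silent (no coordinate "exactly two"). [folklore] -/
def pairMask (row : Fin s → Fin k → Fin 3) (tab : List (List ℕ)) (a b : Fin s) : ℕ :=
  (List.finRange k).foldl (fun m i => m &&& look9 (tab.getD i.val []) (row a i) (row b i)) (2 ^ s - 1)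
/-- Initial table of allowed triples: rows `(a, [(b, pairMask a b)])`, zero masks dropped. [folklore] -/
def initTab (row : Fin s → Fin k → Fin 3) : List (ℕ × List (ℕ × ℕ)) :=
  let tab := colTab row
  (List.finRange s).map fun a => (a.val, (List.finRange s).filterMap fun b =>
    let m := pairMask row tab a b
    if m == 0 then none else some (b.val, m))
/-- Complement of the block mask inside `s` bits. [folklore] -/
def complMask (sN mS : ℕ) : ℕ := (2 ^ sN - 1) ^^^ (mS &&& (2 ^ sN - 1))
/-- Block validity = closedness of `S` (bitmask `mS`) in projection `p` of the table. [folklore] -/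
def mblockValid (sN : ℕ) (T : List (ℕ × List (ℕ × ℕ))) (p mS : ℕ) : Bool :=
  let cS := complMask sN mS
  if p = 0 then T.all fun ra => !(mS.testBit ra.1) || ra.2.all fun bm => mS.testBit bm.1 || bm.2 == 0
  else if p = 1 then T.all fun ra => !(mS.testBit ra.1) || ra.2.all fun bm => bm.2 &&& cS == 0
  else T.all fun ra => ra.2.all fun bm => !(mS.testBit bm.1) || (bm.2 &&& cS == 0)
/-- Apply a block: delete the triples whose projection-`p` edge enters `S` from outside; drop emptied entries. [folklore] -/
def mblockApply (sN : ℕ) (T : List (ℕ × List (ℕ × ℕ))) (p mS : ℕ) : List (ℕ × List (ℕ × ℕ)) :=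
  let cS := complMask sN mS
  if p = 0 then T.map fun ra => if mS.testBit ra.1 then ra else
      (ra.1, ra.2.filter fun bm => !(mS.testBit bm.1))
  else if p = 1 then T.map fun ra => if mS.testBit ra.1 then ra else
      (ra.1, ra.2.filterMap fun bm => if bm.2 &&& cS == 0 then none else some (bm.1, bm.2 &&& cS))
  else T.map fun ra =>
      (ra.1, ra.2.filterMap fun bm => if mS.testBit bm.1 then some bm else
        (if bm.2 &&& cS == 0 then none else some (bm.1, bm.2 &&& cS)))
/-- Run a certificate. [folklore] -/
def maskRun (sN : ℕ) : List (ℕ × List (ℕ × ℕ)) → List (ℕ × ℕ) → Option (List (ℕ × List (ℕ × ℕ)))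
  | T, [] => some T
  | T, (p, mS) :: rest => if mblockValid sN T p mS then maskRun sN (mblockApply sN T p mS) rest else none
/-- Final test: the only surviving bit in row `a` is the diagonal entry `(a, {a})`. [folklore] -/
def mfinalOK (T : List (ℕ × List (ℕ × ℕ))) : Bool :=
  T.all fun ra => ra.2.all fun bm => (ra.1 == bm.1) && (bm.2 &&& 2 ^ ra.1 == bm.2)
/-- The bitmask-table certificate checker. [cite: AndersonJiXu2020, §3.1] -/
def suspMaskCheck (row : Fin s → Fin k → Fin 3) (cert : List (ℕ × ℕ)) : Bool :=
  match maskRun s (initTab row) cert with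
  | none => false
  | some T => mfinalOK T

/-! ## Soundness, layer 1: the bitmask silence computation -/

/-- `exactlyTwoB` agrees with lit's `USPExactlyTwo`. [folklore] -/
theorem exactlyTwoB_iff (a b c : Fin 3) : exactlyTwoB a b c = true ↔ USPExactlyTwo a b c := by
  revert a b c; decide
/-- Bits of an `|||`-fold with powers of two. [folklore] -/
theorem testBit_foldl_or {α : Type*} (L : List α) (P : α → Bool) (f : α → ℕ) (init : ℕ) (j : ℕ) :
    (L.foldl (fun m c => if P c then m else m ||| 2 ^ f c) init).testBit j =
      (init.testBit j || L.any fun c => !P c && decide (f c = j)) := by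
  induction L generalizing init with
  | nil => simp
  | cons x L ih =>
      rw [List.foldl_cons, ih, List.any_cons]
      cases hP : P x
      · simp only [Bool.false_eq_true, ↓reduceIte, Nat.testBit_or, Nat.testBit_two_pow, Bool.not_false, Bool.true_and,
          Bool.or_assoc]
      · simp only [↓reduceIte, Bool.not_true, Bool.false_and, Bool.false_or]
/-- Bits of an `&&&`-fold. [folklore] -/
theorem testBit_foldl_and {α : Type*} (L : List α) (g : α → ℕ) (init : ℕ) (j : ℕ) :
    (L.foldl (fun m c => m &&& g c) init).testBit j = (init.testBit j && L.all fun c => (g c).testBit j) := by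
  induction L generalizing init with
  | nil => simp
  | cons x L ih =>
      simp only [List.foldl_cons, ih, List.all_cons, Nat.testBit_and]
      cases init.testBit j <;> cases (g x).testBit j <;> simp
/-- The column mask's bit `c` is the negated "exactly two" test at coordinate `i`. [folklore] -/
theorem testBit_colMask (row : Fin s → Fin k → Fin 3) (i : Fin k) (x y : Fin 3) (c : Fin s) :
    (colMask row i x y).testBit c.val = !exactlyTwoB x y (row c i) := by
  unfold colMask
  rw [testBit_foldl_or]
  simp only [Nat.zero_testBit, Bool.false_or]
  cases h : exactlyTwoB x y (row c i)
  · -- bit is set: witness c itself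
    simp only [Bool.not_false]
    rw [List.any_eq_true]
    exact ⟨c, List.mem_finRange c, by simp [h]⟩
  · simp only [Bool.not_true]
    rw [Bool.eq_false_iff, ne_eq, List.any_eq_true]
    rintro ⟨c', -, hc'⟩
    simp only [Bool.and_eq_true, Bool.not_eq_true', decide_eq_true_eq] at hc'
    obtain ⟨h1, h2⟩ := hc'
    have : c' = c := Fin.ext h2
    rw [this, h] at h1
    exact Bool.noConfusion h1
/-- `look9` on `colRow` returns the column mask of the symbol pair. [folklore] -/
theorem look9_colRow (row : Fin s → Fin k → Fin 3) (i : Fin k) (x y : Fin 3) :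
    look9 (colRow row i) x y = colMask row i x y := by
  fin_cases x <;> fin_cases y <;> rfl
/-- Table lookup by coordinate. [folklore] -/
theorem colTab_getD (row : Fin s → Fin k → Fin 3) (i : Fin k) :
    (colTab row).getD i.val [] = colRow row i := by
  unfold colTab
  rw [List.getD_eq_getElem?_getD, List.getElem?_map]
  have hi : i.val < (List.finRange k).length := by simp
  rw [List.getElem?_eq_getElem hi]
  simp [List.getElem_finRange]
/-- **The pair mask is the silent set**: for `c : Fin s`, bit `c` of `pairMask a b` is set iff no coordinate has "exactly two"
for the row triple `(a, b, c)`. [folklore] -/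
theorem testBit_pairMask (row : Fin s → Fin k → Fin 3) (a b c : Fin s) :
    (pairMask row (colTab row) a b).testBit c.val = true ↔ ∀ i : Fin k, ¬ USPExactlyTwo (row a i) (row b i) (row c i) := by
  unfold pairMask
  rw [testBit_foldl_and]
  simp only [Nat.testBit_two_pow_sub_one, c.isLt, decide_true, Bool.true_and, List.all_eq_true]
  constructor
  · intro h i
    have hi := h i (List.mem_finRange i)
    rw [colTab_getD, look9_colRow, testBit_colMask] at hi
    rw [← exactlyTwoB_iff]
    simpa using hi
  · intro h i _
    rw [colTab_getD, look9_colRow, testBit_colMask]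
    have := h i
    rw [← exactlyTwoB_iff] at this
    simpa using this

/-! ## Soundness, layer 2: what the table operations preserve -/

/-- The triple `(a, b, c)` (as naturals) is allowed by the table `T` (Boolean form). [folklore] -/
def mAllowedB (T : List (ℕ × List (ℕ × ℕ))) (a b c : ℕ) : Bool :=
  T.any fun ra => (ra.1 == a) && ra.2.any fun bm => (bm.1 == b) && bm.2.testBit c
/-- Unfolding of `mAllowedB`. [folklore] -/
theorem mAllowedB_iff (T : List (ℕ × List (ℕ × ℕ))) (a b c : ℕ) :
    mAllowedB T a b c = true ↔ ∃ ra ∈ T, ra.1 = a ∧ ∃ bm ∈ ra.2, bm.1 = b ∧ bm.2.testBit c = true := by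
  simp only [mAllowedB, List.any_eq_true, Bool.and_eq_true, beq_iff_eq]
/-- A set bit forces a non-zero mask. [folklore] -/
theorem beq_zero_false_of_testBit {m c : ℕ} (h : m.testBit c = true) : (m == 0) = false := by
  cases hm : (m == 0)
  · rfl
  · rw [beq_iff_eq] at hm
    rw [hm, Nat.zero_testBit] at h
    exact Bool.noConfusion h
/-- Silent triples are allowed by the initial table. [folklore] -/
theorem mAllowed_initTab (row : Fin s → Fin k → Fin 3) (a b c : Fin s)
    (hsil : ∀ i : Fin k, ¬ USPExactlyTwo (row a i) (row b i) (row c i)) :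
    mAllowedB (initTab row) a.val b.val c.val = true := by
  have hm : (pairMask row (colTab row) a b).testBit c.val = true := (testBit_pairMask row a b c).2 hsil
  have hne := beq_zero_false_of_testBit hm
  rw [mAllowedB_iff]
  unfold initTab
  dsimp only
  refine ⟨_, List.mem_map.2 ⟨a, List.mem_finRange a, rfl⟩, rfl, (b.val, pairMask row (colTab row) a b), ?_, rfl, hm⟩
  rw [List.mem_filterMap]
  exact ⟨b, List.mem_finRange b, by simp [hne]⟩
/-- Bits of the complement mask inside the `s` window. [folklore] -/
theorem testBit_complMask {sN mS c : ℕ} (hc : c < sN) : (complMask sN mS).testBit c = !mS.testBit c := by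
  unfold complMask
  rw [Nat.testBit_xor, Nat.testBit_and, Nat.testBit_two_pow_sub_one]
  simp only [hc, decide_true, Bool.and_true]
  cases mS.testBit c <;> rfl
/-- A mask `m` with `m &&& n == 0` has no bit inside `n`. [folklore] -/
theorem testBit_false_of_land_beq_zero {m n c : ℕ} (h : (m &&& n == 0) = true) (hn : n.testBit c = true) :
    m.testBit c = false := by
  rw [beq_iff_eq] at h
  have := congrArg (fun x => Nat.testBit x c) h
  simp only [Nat.testBit_and, Nat.zero_testBit, hn, Bool.and_true] at this
  exact this
/-- From `m &&& complMask == 0` and a bit `c < s` of `m`: `c ∈ S`. [folklore] -/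
theorem testBit_of_land_compl_zero {sN mS m c : ℕ} (hc : c < sN) (hz : (m &&& complMask sN mS == 0) = true)
    (hbit : m.testBit c = true) : mS.testBit c = true := by
  cases hmc : mS.testBit c
  · exfalso
    have hcS : (complMask sN mS).testBit c = true := by rw [testBit_complMask hc, hmc]; rfl
    have := testBit_false_of_land_beq_zero hz hcS
    rw [hbit] at this; exact Bool.noConfusion this
  · rfl
/-- Left vertex of a triple under projection `p` (`0`: `a`; `1`: `a`; otherwise `b`). [folklore] -/
def mprojL (p a b _c : ℕ) : ℕ := if p = 0 then a else if p = 1 then a else b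
/-- Right vertex of a triple under projection `p` (`0`: `b`; otherwise `c`). [folklore] -/
def mprojR (p _a b c : ℕ) : ℕ := if p = 0 then b else c
/-- **Validity means closedness**: in a valid block, an allowed triple with left vertex in `S` has right vertex in `S`
(third coordinates inside the `s` window). [folklore] -/
theorem mblockValid_sound {sN : ℕ} {T : List (ℕ × List (ℕ × ℕ))} {p mS : ℕ} (hv : mblockValid sN T p mS = true)
    {a b c : ℕ} (hc : c < sN) (hA : mAllowedB T a b c = true) (hL : mS.testBit (mprojL p a b c) = true) :
    mS.testBit (mprojR p a b c) = true := by
  rw [mAllowedB_iff] at hA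
  obtain ⟨ra, hra, rfl, bm, hbm, rfl, hbit⟩ := hA
  unfold mblockValid at hv
  unfold mprojL at hL; unfold mprojR
  by_cases h0 : p = 0
  · simp only [h0, ↓reduceIte, List.all_eq_true, Bool.or_eq_true, Bool.not_eq_true'] at hv hL ⊢
    rcases hv ra hra with h | h
    · rw [hL] at h; exact Bool.noConfusion h
    · rcases h bm hbm with h' | h'
      · exact h'
      · rw [beq_zero_false_of_testBit hbit] at h'; exact Bool.noConfusion h'
  · by_cases h1 : p = 1
    · simp only [h1, one_ne_zero, ↓reduceIte, List.all_eq_true, Bool.or_eq_true, Bool.not_eq_true'] at hv hL ⊢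
      rcases hv ra hra with h | h
      · rw [hL] at h; exact Bool.noConfusion h
      · exact testBit_of_land_compl_zero hc (h bm hbm) hbit
    · simp only [h0, h1, ↓reduceIte, List.all_eq_true, Bool.or_eq_true, Bool.not_eq_true'] at hv hL ⊢
      rcases hv ra hra bm hbm with h | h
      · rw [hL] at h; exact Bool.noConfusion h
      · exact testBit_of_land_compl_zero hc h hbit
/-- **Surviving a block**: an allowed triple that is not deleted by the block (third coordinate inside the window) is allowed
afterwards. [folklore] -/
theorem mblockApply_keeps {sN : ℕ} {T : List (ℕ × List (ℕ × ℕ))} {p mS : ℕ} {a b c : ℕ} (hc : c < sN)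
    (hA : mAllowedB T a b c = true)
    (hnd : ¬ (mS.testBit (mprojL p a b c) = false ∧ mS.testBit (mprojR p a b c) = true)) :
    mAllowedB (mblockApply sN T p mS) a b c = true := by
  rw [mAllowedB_iff] at hA ⊢
  obtain ⟨ra, hra, rfl, bm, hbm, rfl, hbit⟩ := hA
  unfold mprojL mprojR at hnd
  unfold mblockApply
  dsimp only
  -- the new mask bm.2 &&& cS still has bit c when c ∉ S
  have hnew : mS.testBit c = false → (bm.2 &&& complMask sN mS).testBit c = true := by
    intro hcS
    rw [Nat.testBit_and, hbit, testBit_complMask hc, hcS]; rfl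
  by_cases h0 : p = 0
  · simp only [h0, ↓reduceIte] at hnd ⊢
    refine ⟨_, List.mem_map.2 ⟨ra, hra, rfl⟩, ?_, ?_⟩
    · split <;> rfl
    · by_cases hra1 : mS.testBit ra.1 = true
      · simp only [hra1, ↓reduceIte]; exact ⟨bm, hbm, rfl, hbit⟩
      · rw [Bool.not_eq_true] at hra1
        simp only [hra1, Bool.false_eq_true, ↓reduceIte]
        refine ⟨bm, ?_, rfl, hbit⟩
        rw [List.mem_filter]
        refine ⟨hbm, ?_⟩
        cases hb : mS.testBit bm.1
        · rfl
        · exact absurd ⟨hra1, hb⟩ hnd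
  · by_cases h1 : p = 1
    · simp only [h1, one_ne_zero, ↓reduceIte] at hnd ⊢
      refine ⟨_, List.mem_map.2 ⟨ra, hra, rfl⟩, ?_, ?_⟩
      · split <;> rfl
      · by_cases hra1 : mS.testBit ra.1 = true
        · simp only [hra1, ↓reduceIte]; exact ⟨bm, hbm, rfl, hbit⟩
        · rw [Bool.not_eq_true] at hra1
          simp only [hra1, Bool.false_eq_true, ↓reduceIte]
          have hcS : mS.testBit c = false := by
            cases hmc : mS.testBit c
            · rfl
            · exact absurd ⟨hra1, hmc⟩ hnd
          refine ⟨(bm.1, bm.2 &&& complMask sN mS), ?_, rfl, hnew hcS⟩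
          rw [List.mem_filterMap]
          refine ⟨bm, hbm, ?_⟩
          simp [beq_zero_false_of_testBit (hnew hcS)]
    · simp only [h0, h1, ↓reduceIte] at hnd ⊢
      refine ⟨_, List.mem_map.2 ⟨ra, hra, rfl⟩, rfl, ?_⟩
      by_cases hb1 : mS.testBit bm.1 = true
      · refine ⟨bm, ?_, rfl, hbit⟩
        rw [List.mem_filterMap]; exact ⟨bm, hbm, by simp [hb1]⟩
      · rw [Bool.not_eq_true] at hb1
        have hcS : mS.testBit c = false := by
          cases hmc : mS.testBit c
          · rfl
          · exact absurd ⟨hb1, hmc⟩ hnd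
        refine ⟨(bm.1, bm.2 &&& complMask sN mS), ?_, rfl, hnew hcS⟩
        rw [List.mem_filterMap]
        refine ⟨bm, hbm, ?_⟩
        simp [hb1, beq_zero_false_of_testBit (hnew hcS)]
/-- **Final test**: in an accepted final table, every allowed triple is diagonal. [folklore] -/
theorem mfinalOK_sound {T : List (ℕ × List (ℕ × ℕ))} (hf : mfinalOK T = true) {a b c : ℕ}
    (hA : mAllowedB T a b c = true) : a = b ∧ a = c := by
  rw [mAllowedB_iff] at hA
  obtain ⟨ra, hra, rfl, bm, hbm, rfl, hbit⟩ := hA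
  simp only [mfinalOK, List.all_eq_true, Bool.and_eq_true, beq_iff_eq] at hf
  obtain ⟨hab, hm⟩ := hf ra hra bm hbm
  refine ⟨hab, ?_⟩
  have h2 := congrArg (fun x => Nat.testBit x c) hm
  simp only [Nat.testBit_and, Nat.testBit_two_pow, hbit, Bool.true_and] at h2
  exact of_decide_eq_true h2

/-! ## Soundness, layer 3: the candidate matching survives; conclusion -/

section Matching

variable (π₂ π₃ : Perm (Fin s))
/-- **Block preservation** for the candidate matching `u ↦ (u, π₂ u, π₃ u)`: the permutation `e_R ∘ e_L⁻¹` maps the finite set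
`S` into itself, hence onto itself, so no candidate edge enters `S` from outside. [folklore] -/
theorem mblock_preserves {T : List (ℕ × List (ℕ × ℕ))} {p mS : ℕ}
    (hInv : ∀ u : Fin s, mAllowedB T u.val (π₂ u).val (π₃ u).val = true) (hv : mblockValid s T p mS = true) :
    ∀ u : Fin s, mAllowedB (mblockApply s T p mS) u.val (π₂ u).val (π₃ u).val = true := by
  -- the left/right permutations of projection p
  let eL : Perm (Fin s) := if p = 0 then 1 else if p = 1 then 1 else π₂
  let eR : Perm (Fin s) := if p = 0 then π₂ else π₃
  have hL : ∀ v : Fin s, mprojL p v.val (π₂ v).val (π₃ v).val = (eL v).val := by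
    intro v; simp only [mprojL, eL]; split_ifs <;> rfl
  have hR : ∀ v : Fin s, mprojR p v.val (π₂ v).val (π₃ v).val = (eR v).val := by
    intro v; simp only [mprojR, eR]; split_ifs <;> rfl
  have hcl : ∀ v : Fin s, mS.testBit (eL v).val = true → mS.testBit (eR v).val = true := by
    intro v hv'
    have := mblockValid_sound hv (π₃ v).isLt (hInv v) (by rw [hL]; exact hv')
    rwa [hR] at this
  let g : Perm (Fin s) := eL.symm.trans eR
  have hg : ∀ l : Fin s, mS.testBit l.val = true → mS.testBit (g l).val = true := by
    intro l hl
    have := hcl (eL.symm l) (by rw [Equiv.apply_symm_apply]; exact hl)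
    simpa [g] using this
  let TT : Finset (Fin s) := Finset.univ.filter fun v => mS.testBit v.val = true
  have hsub : TT.image g ⊆ TT := by
    intro w hw
    simp only [Finset.mem_image] at hw
    obtain ⟨l, hl, rfl⟩ := hw
    simp only [TT, Finset.mem_filter, Finset.mem_univ, true_and] at hl ⊢
    exact hg l hl
  have hcard : TT.card ≤ (TT.image g).card := by
    rw [Finset.card_image_of_injective TT g.injective]
  have heq : TT.image g = TT := Finset.eq_of_subset_of_card_le hsub hcard
  intro u
  apply mblockApply_keeps (π₃ u).isLt (hInv u)
  rintro ⟨hx, hy⟩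
  rw [hL] at hx; rw [hR] at hy
  have hyT : eR u ∈ TT := by
    simp only [TT, Finset.mem_filter, Finset.mem_univ, true_and]; exact hy
  rw [← heq, Finset.mem_image] at hyT
  obtain ⟨l, hlT, hl⟩ := hyT
  have hl' : l = eL u := by
    have : eR (eL.symm l) = eR u := by simpa [g] using hl
    have h2 := eR.injective this
    simpa using congrArg eL h2
  simp only [TT, Finset.mem_filter, Finset.mem_univ, true_and] at hlT
  rw [hl', hx] at hlT
  exact Bool.noConfusion hlT
/-- Running a certificate preserves the candidate matching. [folklore] -/
theorem maskRun_preserves : ∀ (T : List (ℕ × List (ℕ × ℕ))) (cert : List (ℕ × ℕ)) (B : List (ℕ × List (ℕ × ℕ))),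
    (∀ u : Fin s, mAllowedB T u.val (π₂ u).val (π₃ u).val = true) → maskRun s T cert = some B →
    ∀ u : Fin s, mAllowedB B u.val (π₂ u).val (π₃ u).val = true
  | T, [], B, hInv, h => by
      simp only [maskRun, Option.some.injEq] at h
      exact h ▸ hInv
  | T, (p, mS) :: rest, B, hInv, h => by
      simp only [maskRun] at h
      split_ifs at h with hv
      exact maskRun_preserves (mblockApply s T p mS) rest B (mblock_preserves π₂ π₃ hInv hv) h

end Matching
/-- **Soundness of the bitmask-table certificate checker**: `suspMaskCheck row cert = true → IsStrongUSP row`.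
[cite: CohnKleinbergSzegedyUmans2005, §3 (p. 5)] [cite: AndersonJiXu2020, §3.1] -/
theorem isStrongUSP_of_suspMaskCheck {row : Fin s → Fin k → Fin 3} {cert : List (ℕ × ℕ)}
    (h : suspMaskCheck row cert = true) : IsStrongUSP row := by
  rw [isStrongUSP_iff_fix_first]
  intro π₂ π₃
  by_cases hex : ∃ u : Fin s, ∃ i : Fin k, USPExactlyTwo (row u i) (row (π₂ u) i) (row (π₃ u) i)
  · exact Or.inr hex
  · left
    simp only [not_exists] at hex
    have hInv : ∀ u : Fin s, mAllowedB (initTab row) u.val (π₂ u).val (π₃ u).val = true :=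
      fun u => mAllowed_initTab row u (π₂ u) (π₃ u) (hex u)
    unfold suspMaskCheck at h
    split at h
    · exact absurd h Bool.false_ne_true
    · rename_i B hrun
      have hB := maskRun_preserves π₂ π₃ _ _ B hInv hrun
      constructor
      · exact Equiv.ext fun u => Fin.ext ((mfinalOK_sound h (hB u)).1).symm
      · exact Equiv.ext fun u => Fin.ext ((mfinalOK_sound h (hB u)).2).symm

end Summit.MatrixMultiplication.OmegaCensus
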